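/-
Copyright (c) 2026. All rights reserved.
Released under Apache 2.0 license as described in the file LICENSE.
-/
import Literature.Geometry.Kaehler.ComplexTorusQuaternionXSixSpecialCyclesDegreeEulerProduct
import HarnessLib

/-!
# The two CM-elliptic towers of special cycles on `X₆` in closed form:
# `deg Z(k²)_ℚ = Σ_{c ∣ k, (c,6)=1} c∏_{ℓ∣c}(1 − χ₄(ℓ)ℓ⁻¹)` and `deg Z(3k²)_ℚ = (2/3)·Σ_{c ∣ k, (c,6)=1} c∏_{ℓ∣c}(1 − (−3∕ℓ)ℓ⁻¹)`
# for every `k ≥ 1`, with the class counts `|L(k²)/O₆^×|`, `|L(3k²)/O₆^×|`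

[tag: complex_torus] [tag: abelian_surface] [tag: quaternion_multiplication] [tag: complex_multiplication]
[tag: shimura_curve] [tag: special_cycles] [tag: class_number]

Lane `lit-hodgefound`, seat p12, row g41-#6 — THEOREMS ONLY (no definition, no named fact, no instance). The indices
`t = k²` and `t = 3k²` are exactly those for which `k_t = ℚ(√−t)` is `ℚ(i)` resp. `ℚ(√−3)` — the CM fields of the two
elliptic points of `X₆` of orders `2` and `3` — and exactly those where the degree `deg Z(t)_ℚ = 2Σᶠ e_x⁻¹` differs from
the plain class count `|L(t)/O₆^×|` (the tree's `degree_trichotomy`, `degree_eq_card_sub_one_of_sq`,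
`degree_eq_card_sub_of_three_mul_sq`). In KRY's parametrisation `4t = n²d` they are the towers `d = −4, n = k` and
`d = −3, n = 2k` (the tree's `conductor_of_sq`, `conductor_of_three_mul_sq`), so the second printed form of (3.4.6)
(`kry_degree_formula_second_form`) evaluates completely: `2δ(−4; 6)h(−4)/w(−4) = 2·(1 − χ₈(−4))(1 − (−4∕3))·¼ = 1` and
`2δ(−3; 6)h(−3)/w(−3) = 2·(1 − χ₈(−3))(1 − (−3∕3))·⅙ = 2/3`, leaving only the multiplicative inner sum, whose local
factors are those of row g41-#5 (`sum_psi_prime_pow`). Notation as in the sibling files (`t` is `m` in the code,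
`deg Z(t)_ℚ = 2·Σᶠ_{[x] ∈ L(t)/O₆^×} e_x⁻¹`, `χ₄ = ZMod.χ₄`, `(a∕ℓ) = jacobiSym a ℓ`).

## The print

* S. Kudla, M. Rapoport, T. Yang, *Modular Forms and Special Cycles on Shimura Curves*, Annals of Math. Studies 161
  (2006), §3.4 p. 45 (held p0053): (3.4.4)–(3.4.6) (second form
  `H₀(t; D) = (h(d)/w(d))·Σ_{c∣n, (c,D)=1} c∏_{ℓ∣c}(1 − χ_d(ℓ)ℓ⁻¹)`), the parametrisation `4t = n²d`, and (3.4.14)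
  `deg 𝒵(t)_ℚ = 2Σ_{x ∈ L(t) mod Γ} e_x⁻¹`. [cite: KudlaRapoportYang2006, §3.4 (3.4.4)–(3.4.6) and (3.4.14)]
* D. A. Cox, *Primes of the form x² + ny²*, 2nd ed. (2013), §7.A (7.3) and Thm. 7.24. [cite: Cox2013, §7.A (7.3) and Thm. 7.24]
* M. Eichler, *Zur Zahlentheorie der Quaternionen-Algebren*, J. reine angew. Math. 195 (1955), Satz 5 (the class
  count of optimal embeddings behind `|L(t)/O₆^×|`). [cite: Eichler1955, Satz 5]

## What is proved (every `k ≥ 1`, every prime `p ≥ 5`, every `e ≥ 0`)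

* §1 **`degree_sq`** (`deg Z(k²)_ℚ = Σ_{c∣k,(c,6)=1} c∏_{ℓ∣c}(1 − χ₄(ℓ)ℓ⁻¹)`), **`degree_three_mul_sq`**
  (`deg Z(3k²)_ℚ = (2/3)Σ_{c∣k,(c,6)=1} c∏_{ℓ∣c}(1 − (−3∕ℓ)ℓ⁻¹)`); `degree_sq_eq_one_of_primeFactors_subset` and
  `degree_three_mul_sq_eq_of_primeFactors_subset` (`k = 2^a3^b`: `deg Z(k²) = 1`, `deg Z(3k²) = 2/3`);
  **`degree_prime_pow_sq`** (`deg Z(p^{2e})_ℚ = 1 + (p − χ₄(p))(1 + p + ⋯ + p^{e−1})`),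
  **`degree_three_mul_prime_pow_sq`** (`deg Z(3p^{2e})_ℚ = (2/3)(1 + (p − (−3∕p))(1 + p + ⋯ + p^{e−1}))`).
* §2 **`card_unit_classes_sq`** (`|L(k²)/O₆^×| = 1 + Σ_{c∣k,(c,6)=1} c∏(1 − χ₄(ℓ)ℓ⁻¹)`),
  **`card_unit_classes_three_mul_sq`** (`|L(3k²)/O₆^×| = 4/3 + (2/3)Σ_{c∣k,(c,6)=1} c∏(1 − (−3∕ℓ)ℓ⁻¹)`).
* §3 values: `degree_sixteen` (`= 1`), `degree_fortyeight` (`= 2/3`), `degree_twothousandfourhundredone`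
  (`deg Z(7⁴)_ℚ = 1 + 8·8 = 65`), `card_unit_classes_fortynine` (`|L(49)/O₆^×| = 10`).

## Scope (honest)

Only `D(B) = 6`; for `t` outside the two towers `deg Z(t)_ℚ = |L(t)/O₆^×|` and the general Euler product of row g41-#5
(`kry_degree_formula_euler`) is the closed form — nothing new is said about those `t` here.
-/

set_option maxSynthPendingDepth 3

open Quaternion Function
open scoped Pointwise
open Literature.NumberTheory.Automorphic Literature.NumberTheory.Automorphic.Brandt
open Literature.NumberTheory.Automorphic.HeckeTraceFormulaGL2Level (ellipticConductors weightedClassNumber)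
open Literature.NumberTheory.QuadraticFields.Quadratic (BinQF.classNumber)

namespace Literature.Geometry.Kaehler.ComplexTorus.QuaternionType

/-! ## §1 The two towers in closed form -/

section Towers

/-- `(a·2² ∕ ℓ) = (a ∕ ℓ)` for odd `ℓ`. [folklore] -/
private theorem jacobiSym_mul_four₄₆ (a : ℤ) {ℓ : ℕ} (hℓ : Odd ℓ) : jacobiSym (a * 2 ^ 2) ℓ = jacobiSym a ℓ := by
  rw [jacobiSym.mul_left, jacobiSym.sq_one' (by
    rw [show (2 : ℤ) = ((2 : ℕ) : ℤ) by rfl, Int.gcd_natCast_natCast]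
    exact Nat.coprime_two_left.2 hℓ), mul_one]

/-- `(−4 ∕ ℓ) = χ₄(ℓ)` for odd `ℓ`. [folklore] -/
private theorem jacobiSym_neg_four₄₆ {ℓ : ℕ} (hℓ : Odd ℓ) : jacobiSym (-4) ℓ = ZMod.χ₄ ℓ := by
  rw [show (-4 : ℤ) = -1 * 2 ^ 2 by norm_num, jacobiSym_mul_four₄₆ _ hℓ, jacobiSym.at_neg_one hℓ]

/-- On the divisors coprime to `6` the symbol `(−4∕ℓ)` is `χ₄(ℓ)` termwise. [folklore] -/
private theorem sum_psi_neg_four_eq₄₆ (k : ℕ) :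
    ∑ c ∈ (k.divisors.filter fun c : ℕ => c.Coprime 6), ((c : ℚ) * ∏ ℓ ∈ (c : ℕ).primeFactors, (1 - (jacobiSym (-4) ℓ : ℚ) / ℓ)) =
      ∑ c ∈ (k.divisors.filter fun c : ℕ => c.Coprime 6),
        ((c : ℚ) * ∏ ℓ ∈ c.primeFactors, (1 - (ZMod.χ₄ ℓ : ℚ) / ℓ)) := by
  refine Finset.sum_congr rfl fun c hc ↦ ?_
  have hc6 : c.Coprime 6 := (Finset.mem_filter.1 hc).2
  congr 1
  refine Finset.prod_congr rfl fun ℓ hℓ ↦ ?_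
  have hℓp : ℓ.Prime := Nat.prime_of_mem_primeFactors hℓ
  have hℓ6 : ℓ.Coprime 6 := Nat.Coprime.coprime_dvd_left (Nat.dvd_of_mem_primeFactors hℓ) hc6
  have hℓ2 : ℓ ≠ 2 := by rintro rfl; exact absurd hℓ6 (by decide)
  rw [jacobiSym_neg_four₄₆ (hℓp.odd_of_ne_two hℓ2)]

/-- The divisors of `kN` coprime to `6` are those of `N` when `k ∣ 6`. [folklore] -/
private theorem divisors_filter_mul_of_dvd_six₄₆ {k N : ℕ} (hk : k ∣ 6) (hN : N ≠ 0) :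
    ((k * N).divisors.filter fun c : ℕ => c.Coprime 6) = (N.divisors.filter fun c : ℕ => c.Coprime 6) := by
  have hk0 : k ≠ 0 := by rintro rfl; exact absurd hk (by decide)
  ext c
  simp only [Finset.mem_filter, Nat.mem_divisors]
  constructor
  · rintro ⟨⟨hc, -⟩, h6⟩
    exact ⟨⟨(Nat.Coprime.coprime_dvd_right hk h6).dvd_of_dvd_mul_left hc, hN⟩, h6⟩
  · rintro ⟨⟨hc, -⟩, h6⟩
    exact ⟨⟨hc.mul_left k, mul_ne_zero hk0 hN⟩, h6⟩

/-- **THE `ℚ(i)`-TOWER: `deg Z(k²)_ℚ = Σ_{c ∣ k, (c,6)=1} c·∏_{ℓ∣c}(1 − χ₄(ℓ)ℓ⁻¹)` FOR EVERY `k ≥ 1`** (`4t = n²d` with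
`n = k`, `d = −4`: `2δ(−4; 6)·h(−4)/w(−4) = 2·(1 − χ₈(−4))(1 − (−4∕3))·¼ = 2·1·2·¼ = 1`; the CM points by orders of
`ℚ(i)`, over the elliptic points of order `2`). [cite: KudlaRapoportYang2006, §3.4 (3.4.4)–(3.4.6) and (3.4.14)] [cite: Cox2013, Thm. 7.24] -/
theorem degree_sq {k : ℕ} (hk : 0 < k) :
    2 * ∑ᶠ q : (Quot (fun x y : {x : ℤ × ℤ × ℤ // x.1 ^ 2 - 3 * x.2.1 ^ 2 - 3 * x.2.2 ^ 2 = ((k ^ 2 : ℕ) : ℤ)} ↦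
      ∃ v : ℍ[ℚ,((-1 : ℤ) : ℚ),((3 : ℤ) : ℚ)], (v ∈ order (-1) 3 ∨ v - ⟨1/2, 1/2, 1/2, -1/2⟩ ∈ order (-1) 3) ∧
        ((v * star v).re = 1 ∨ (v * star v).re = -1) ∧
        v * ⟨0, x.1.1, x.1.2.1, x.1.2.2⟩ = ⟨0, y.1.1, y.1.2.1, y.1.2.2⟩ * v)),
        ((Nat.card
          {u : ℍ[ℚ,((-1 : ℤ) : ℚ),((3 : ℤ) : ℚ)] // (u ∈ order (-1) 3 ∨ u - ⟨1/2, 1/2, 1/2, -1/2⟩ ∈ order (-1) 3) ∧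
            ((u * star u).re = 1 ∨ (u * star u).re = -1) ∧
            u * ⟨0, q.out.1.1, q.out.1.2.1, q.out.1.2.2⟩ = ⟨0, q.out.1.1, q.out.1.2.1, q.out.1.2.2⟩ * u} : ℚ))⁻¹ =
      ∑ c ∈ (k.divisors.filter fun c : ℕ => c.Coprime 6), ((c : ℚ) * ∏ ℓ ∈ c.primeFactors, (1 - (ZMod.χ₄ ℓ : ℚ) / ℓ)) := by
  have hm : 0 < k ^ 2 := by positivity
  obtain ⟨hF, hD⟩ := conductor_of_sq hk
  rw [kry_degree_formula_second_form hm, hD, hF, ← sum_psi_neg_four_eq₄₆]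
  have hh : BinQF.classNumber (-4) = 1 := by decide +kernel
  have h8 : ZMod.χ₈ ((-4 : ℤ) : ZMod 8) = 0 := by decide
  have h3 : legendreSym 3 (-4) = -1 := by norm_num
  have hw : unitsOfDisc (-4) = 4 := by decide
  rw [hh, h8, h3, hw]
  push_cast; ring

/-- **THE `ℚ(√−3)`-TOWER: `deg Z(3k²)_ℚ = (2/3)·Σ_{c ∣ k, (c,6)=1} c·∏_{ℓ∣c}(1 − (−3∕ℓ)ℓ⁻¹)` FOR EVERY `k ≥ 1`**
(`n = 2k`, `d = −3`: `2δ(−3; 6)·h(−3)/w(−3) = 2·(1 − χ₈(−3))(1 − 0)·⅙ = 2·2·⅙ = 2/3`, and the divisors of `2k` coprime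
to `6` are those of `k`; the CM points by orders of `ℚ(√−3)`, over the elliptic points of order `3`).
[cite: KudlaRapoportYang2006, §3.4 (3.4.4)–(3.4.6) and (3.4.14)] [cite: Cox2013, Thm. 7.24] -/
theorem degree_three_mul_sq {k : ℕ} (hk : 0 < k) :
    2 * ∑ᶠ q : (Quot (fun x y : {x : ℤ × ℤ × ℤ // x.1 ^ 2 - 3 * x.2.1 ^ 2 - 3 * x.2.2 ^ 2 = ((3 * k ^ 2 : ℕ) : ℤ)} ↦
      ∃ v : ℍ[ℚ,((-1 : ℤ) : ℚ),((3 : ℤ) : ℚ)], (v ∈ order (-1) 3 ∨ v - ⟨1/2, 1/2, 1/2, -1/2⟩ ∈ order (-1) 3) ∧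
        ((v * star v).re = 1 ∨ (v * star v).re = -1) ∧
        v * ⟨0, x.1.1, x.1.2.1, x.1.2.2⟩ = ⟨0, y.1.1, y.1.2.1, y.1.2.2⟩ * v)),
        ((Nat.card
          {u : ℍ[ℚ,((-1 : ℤ) : ℚ),((3 : ℤ) : ℚ)] // (u ∈ order (-1) 3 ∨ u - ⟨1/2, 1/2, 1/2, -1/2⟩ ∈ order (-1) 3) ∧
            ((u * star u).re = 1 ∨ (u * star u).re = -1) ∧
            u * ⟨0, q.out.1.1, q.out.1.2.1, q.out.1.2.2⟩ = ⟨0, q.out.1.1, q.out.1.2.1, q.out.1.2.2⟩ * u} : ℚ))⁻¹ =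
      2 / 3 * ∑ c ∈ (k.divisors.filter fun c : ℕ => c.Coprime 6), ((c : ℚ) * ∏ ℓ ∈ (c : ℕ).primeFactors, (1 - (jacobiSym (-3) ℓ : ℚ) / ℓ)) := by
  have hm : 0 < 3 * k ^ 2 := by positivity
  obtain ⟨hF, hD⟩ := conductor_of_three_mul_sq hk
  rw [kry_degree_formula_second_form hm, hD, hF, divisors_filter_mul_of_dvd_six₄₆ (by norm_num : 2 ∣ 6) hk.ne']
  have hh : BinQF.classNumber (-3) = 1 := by decide +kernel
  have h8 : ZMod.χ₈ ((-3 : ℤ) : ZMod 8) = -1 := by decide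
  have h3 : legendreSym 3 (-3) = 0 := by norm_num
  have hw : unitsOfDisc (-3) = 6 := by decide
  rw [hh, h8, h3, hw]
  push_cast; ring

/-- For `k` with no prime factor `≥ 5` only `c = 1` is a divisor coprime to `6`. [folklore] -/
private theorem divisors_filter_eq_singleton₄₆ {k : ℕ} (hk : 0 < k) (h : k.primeFactors ⊆ {2, 3}) :
    (k.divisors.filter fun c : ℕ => c.Coprime 6) = {1} := by
  ext c
  simp only [Finset.mem_filter, Nat.mem_divisors, Finset.mem_singleton]
  constructor
  · rintro ⟨⟨hc, -⟩, h6⟩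
    have hc0 : c ≠ 0 := by rintro rfl; exact absurd h6 (by decide)
    have hem : c.primeFactors = ∅ := Finset.subset_empty.1 fun ℓ hℓ ↦ by
      have hℓk : ℓ ∈ ({2, 3} : Finset ℕ) := h (Nat.primeFactors_mono hc hk.ne' hℓ)
      have hℓ6 : ℓ.Coprime 6 := Nat.Coprime.coprime_dvd_left (Nat.dvd_of_mem_primeFactors hℓ) h6
      simp only [Finset.mem_insert, Finset.mem_singleton] at hℓk
      rcases hℓk with rfl | rfl
      · exact absurd hℓ6 (by decide)
      · exact absurd hℓ6 (by decide)
    rcases Nat.primeFactors_eq_empty.1 hem with h0 | h1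
    · exact absurd h0 hc0
    · exact h1
  · rintro rfl
    exact ⟨⟨one_dvd _, hk.ne'⟩, Nat.coprime_one_left 6⟩

/-- **`deg Z(k²)_ℚ = 1` whenever `k` has no prime factor `≥ 5`** (`k = 2^a3^b`: `deg Z(1) = deg Z(4) = deg Z(9) =
deg Z(16) = deg Z(36) = deg Z(144) = ⋯ = 1`). [cite: KudlaRapoportYang2006, §3.4 (3.4.4)–(3.4.6) and (3.4.14)] -/
theorem degree_sq_eq_one_of_primeFactors_subset {k : ℕ} (hk : 0 < k) (h : k.primeFactors ⊆ {2, 3}) :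
    2 * ∑ᶠ q : (Quot (fun x y : {x : ℤ × ℤ × ℤ // x.1 ^ 2 - 3 * x.2.1 ^ 2 - 3 * x.2.2 ^ 2 = ((k ^ 2 : ℕ) : ℤ)} ↦
      ∃ v : ℍ[ℚ,((-1 : ℤ) : ℚ),((3 : ℤ) : ℚ)], (v ∈ order (-1) 3 ∨ v - ⟨1/2, 1/2, 1/2, -1/2⟩ ∈ order (-1) 3) ∧
        ((v * star v).re = 1 ∨ (v * star v).re = -1) ∧
        v * ⟨0, x.1.1, x.1.2.1, x.1.2.2⟩ = ⟨0, y.1.1, y.1.2.1, y.1.2.2⟩ * v)),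
        ((Nat.card
          {u : ℍ[ℚ,((-1 : ℤ) : ℚ),((3 : ℤ) : ℚ)] // (u ∈ order (-1) 3 ∨ u - ⟨1/2, 1/2, 1/2, -1/2⟩ ∈ order (-1) 3) ∧
            ((u * star u).re = 1 ∨ (u * star u).re = -1) ∧
            u * ⟨0, q.out.1.1, q.out.1.2.1, q.out.1.2.2⟩ = ⟨0, q.out.1.1, q.out.1.2.1, q.out.1.2.2⟩ * u} : ℚ))⁻¹ = 1 := by
  rw [degree_sq hk, divisors_filter_eq_singleton₄₆ hk h, Finset.sum_singleton, Nat.primeFactors_one,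
    Finset.prod_empty]
  push_cast; ring

/-- **`deg Z(3k²)_ℚ = 2/3` whenever `k` has no prime factor `≥ 5`** (`deg Z(3) = deg Z(12) = deg Z(27) = deg Z(48) =
⋯ = 2/3`). [cite: KudlaRapoportYang2006, §3.4 (3.4.4)–(3.4.6) and (3.4.14)] -/
theorem degree_three_mul_sq_eq_of_primeFactors_subset {k : ℕ} (hk : 0 < k) (h : k.primeFactors ⊆ {2, 3}) :
    2 * ∑ᶠ q : (Quot (fun x y : {x : ℤ × ℤ × ℤ // x.1 ^ 2 - 3 * x.2.1 ^ 2 - 3 * x.2.2 ^ 2 = ((3 * k ^ 2 : ℕ) : ℤ)} ↦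
      ∃ v : ℍ[ℚ,((-1 : ℤ) : ℚ),((3 : ℤ) : ℚ)], (v ∈ order (-1) 3 ∨ v - ⟨1/2, 1/2, 1/2, -1/2⟩ ∈ order (-1) 3) ∧
        ((v * star v).re = 1 ∨ (v * star v).re = -1) ∧
        v * ⟨0, x.1.1, x.1.2.1, x.1.2.2⟩ = ⟨0, y.1.1, y.1.2.1, y.1.2.2⟩ * v)),
        ((Nat.card
          {u : ℍ[ℚ,((-1 : ℤ) : ℚ),((3 : ℤ) : ℚ)] // (u ∈ order (-1) 3 ∨ u - ⟨1/2, 1/2, 1/2, -1/2⟩ ∈ order (-1) 3) ∧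
            ((u * star u).re = 1 ∨ (u * star u).re = -1) ∧
            u * ⟨0, q.out.1.1, q.out.1.2.1, q.out.1.2.2⟩ = ⟨0, q.out.1.1, q.out.1.2.1, q.out.1.2.2⟩ * u} : ℚ))⁻¹ = 2 / 3 := by
  rw [degree_three_mul_sq hk, divisors_filter_eq_singleton₄₆ hk h, Finset.sum_singleton, Nat.primeFactors_one,
    Finset.prod_empty]
  push_cast; ring

/-- **`deg Z(p^{2e})_ℚ = 1 + (p − χ₄(p))·(1 + p + ⋯ + p^{e−1})` for every prime `p ≥ 5`** (`= p^e` if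
`p ≡ 1 (mod 4)`, `= 1 + (p + 1)(p^e − 1)/(p − 1)` if `p ≡ 3 (mod 4)`).
[cite: KudlaRapoportYang2006, §3.4 (3.4.4)–(3.4.6)] [cite: Cox2013, Thm. 7.24] -/
theorem degree_prime_pow_sq {p : ℕ} (hp : p.Prime) (h2 : p ≠ 2) (h3 : p ≠ 3) (e : ℕ) :
    2 * ∑ᶠ q : (Quot (fun x y : {x : ℤ × ℤ × ℤ // x.1 ^ 2 - 3 * x.2.1 ^ 2 - 3 * x.2.2 ^ 2 = ((p ^ (2 * e) : ℕ) : ℤ)} ↦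
      ∃ v : ℍ[ℚ,((-1 : ℤ) : ℚ),((3 : ℤ) : ℚ)], (v ∈ order (-1) 3 ∨ v - ⟨1/2, 1/2, 1/2, -1/2⟩ ∈ order (-1) 3) ∧
        ((v * star v).re = 1 ∨ (v * star v).re = -1) ∧
        v * ⟨0, x.1.1, x.1.2.1, x.1.2.2⟩ = ⟨0, y.1.1, y.1.2.1, y.1.2.2⟩ * v)),
        ((Nat.card
          {u : ℍ[ℚ,((-1 : ℤ) : ℚ),((3 : ℤ) : ℚ)] // (u ∈ order (-1) 3 ∨ u - ⟨1/2, 1/2, 1/2, -1/2⟩ ∈ order (-1) 3) ∧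
            ((u * star u).re = 1 ∨ (u * star u).re = -1) ∧
            u * ⟨0, q.out.1.1, q.out.1.2.1, q.out.1.2.2⟩ = ⟨0, q.out.1.1, q.out.1.2.1, q.out.1.2.2⟩ * u} : ℚ))⁻¹ = 1 + ((p : ℚ) - ZMod.χ₄ p) * ∑ i ∈ Finset.range e, (p : ℚ) ^ i := by
  have hp6 : p.Coprime 6 := by
    rw [show (6 : ℕ) = 2 * 3 from rfl, Nat.coprime_mul_iff_right]
    exact ⟨(Nat.coprime_primes hp Nat.prime_two).2 h2, (Nat.coprime_primes hp Nat.prime_three).2 h3⟩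
  rw [show (p ^ (2 * e) : ℕ) = (p ^ e) ^ 2 from pow_mul' p 2 e, degree_sq (pow_pos hp.pos e),
    ← sum_psi_neg_four_eq₄₆, sum_psi_prime_pow (-4) hp hp6 e, jacobiSym_neg_four₄₆ (hp.odd_of_ne_two h2)]

/-- **`deg Z(3p^{2e})_ℚ = (2/3)·(1 + (p − (−3∕p))·(1 + p + ⋯ + p^{e−1}))` for every prime `p ≥ 5`.**
[cite: KudlaRapoportYang2006, §3.4 (3.4.4)–(3.4.6)] [cite: Cox2013, Thm. 7.24] -/
theorem degree_three_mul_prime_pow_sq {p : ℕ} (hp : p.Prime) (h2 : p ≠ 2) (h3 : p ≠ 3) (e : ℕ) :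
    2 * ∑ᶠ q : (Quot (fun x y : {x : ℤ × ℤ × ℤ // x.1 ^ 2 - 3 * x.2.1 ^ 2 - 3 * x.2.2 ^ 2 = ((3 * p ^ (2 * e) : ℕ) : ℤ)} ↦
      ∃ v : ℍ[ℚ,((-1 : ℤ) : ℚ),((3 : ℤ) : ℚ)], (v ∈ order (-1) 3 ∨ v - ⟨1/2, 1/2, 1/2, -1/2⟩ ∈ order (-1) 3) ∧
        ((v * star v).re = 1 ∨ (v * star v).re = -1) ∧
        v * ⟨0, x.1.1, x.1.2.1, x.1.2.2⟩ = ⟨0, y.1.1, y.1.2.1, y.1.2.2⟩ * v)),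
        ((Nat.card
          {u : ℍ[ℚ,((-1 : ℤ) : ℚ),((3 : ℤ) : ℚ)] // (u ∈ order (-1) 3 ∨ u - ⟨1/2, 1/2, 1/2, -1/2⟩ ∈ order (-1) 3) ∧
            ((u * star u).re = 1 ∨ (u * star u).re = -1) ∧
            u * ⟨0, q.out.1.1, q.out.1.2.1, q.out.1.2.2⟩ = ⟨0, q.out.1.1, q.out.1.2.1, q.out.1.2.2⟩ * u} : ℚ))⁻¹ =
      2 / 3 * (1 + ((p : ℚ) - jacobiSym (-3) p) * ∑ i ∈ Finset.range e, (p : ℚ) ^ i) := by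
  have hp6 : p.Coprime 6 := by
    rw [show (6 : ℕ) = 2 * 3 from rfl, Nat.coprime_mul_iff_right]
    exact ⟨(Nat.coprime_primes hp Nat.prime_two).2 h2, (Nat.coprime_primes hp Nat.prime_three).2 h3⟩
  rw [show (3 * p ^ (2 * e) : ℕ) = 3 * (p ^ e) ^ 2 by rw [pow_mul' p 2 e], degree_three_mul_sq (pow_pos hp.pos e),
    sum_psi_prime_pow (-3) hp hp6 e]

end Towers

/-! ## §2 The class counts `|L(k²)/O₆^×|` and `|L(3k²)/O₆^×|` -/

section ClassCounts

/-- **`|L(k²)/O₆^×| = 1 + Σ_{c ∣ k, (c,6)=1} c·∏_{ℓ∣c}(1 − χ₄(ℓ)ℓ⁻¹)`** (every `k ≥ 1`; `deg Z(t)_ℚ = |L(t)/O₆^×| − 1` on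
the squares, `degree_eq_card_sub_one_of_sq`). [cite: KudlaRapoportYang2006, §3.4 (3.4.4)–(3.4.6) and (3.4.14)] [cite: Eichler1955, Satz 5] -/
theorem card_unit_classes_sq {k : ℕ} (hk : 0 < k) :
    (Nat.card (Quot (fun x y : {x : ℤ × ℤ × ℤ // x.1 ^ 2 - 3 * x.2.1 ^ 2 - 3 * x.2.2 ^ 2 = ((k ^ 2 : ℕ) : ℤ)} ↦
      ∃ v : ℍ[ℚ,((-1 : ℤ) : ℚ),((3 : ℤ) : ℚ)], (v ∈ order (-1) 3 ∨ v - ⟨1/2, 1/2, 1/2, -1/2⟩ ∈ order (-1) 3) ∧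
        ((v * star v).re = 1 ∨ (v * star v).re = -1) ∧
        v * ⟨0, x.1.1, x.1.2.1, x.1.2.2⟩ = ⟨0, y.1.1, y.1.2.1, y.1.2.2⟩ * v)) : ℚ) =
      1 + ∑ c ∈ (k.divisors.filter fun c : ℕ => c.Coprime 6), ((c : ℚ) * ∏ ℓ ∈ c.primeFactors, (1 - (ZMod.χ₄ ℓ : ℚ) / ℓ)) := by
  have h := degree_eq_card_sub_one_of_sq (t := ((k ^ 2 : ℕ) : ℤ)) (by positivity) ⟨k, by push_cast; ring⟩
  rw [degree_sq hk] at h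
  linarith

/-- **`|L(3k²)/O₆^×| = 4/3 + (2/3)·Σ_{c ∣ k, (c,6)=1} c·∏_{ℓ∣c}(1 − (−3∕ℓ)ℓ⁻¹)`** (every `k ≥ 1`;
`deg Z(t)_ℚ = |L(t)/O₆^×| − 4/3` on `3·`squares, `degree_eq_card_sub_of_three_mul_sq`).
[cite: KudlaRapoportYang2006, §3.4 (3.4.4)–(3.4.6) and (3.4.14)] [cite: Eichler1955, Satz 5] -/
theorem card_unit_classes_three_mul_sq {k : ℕ} (hk : 0 < k) :
    (Nat.card (Quot (fun x y : {x : ℤ × ℤ × ℤ // x.1 ^ 2 - 3 * x.2.1 ^ 2 - 3 * x.2.2 ^ 2 = ((3 * k ^ 2 : ℕ) : ℤ)} ↦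
      ∃ v : ℍ[ℚ,((-1 : ℤ) : ℚ),((3 : ℤ) : ℚ)], (v ∈ order (-1) 3 ∨ v - ⟨1/2, 1/2, 1/2, -1/2⟩ ∈ order (-1) 3) ∧
        ((v * star v).re = 1 ∨ (v * star v).re = -1) ∧
        v * ⟨0, x.1.1, x.1.2.1, x.1.2.2⟩ = ⟨0, y.1.1, y.1.2.1, y.1.2.2⟩ * v)) : ℚ) =
      4 / 3 + 2 / 3 * ∑ c ∈ (k.divisors.filter fun c : ℕ => c.Coprime 6), ((c : ℚ) * ∏ ℓ ∈ (c : ℕ).primeFactors, (1 - (jacobiSym (-3) ℓ : ℚ) / ℓ)) := by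
  have h := degree_eq_card_sub_of_three_mul_sq (t := ((3 * k ^ 2 : ℕ) : ℤ)) (by positivity) ⟨k, by push_cast; ring⟩
  rw [degree_three_mul_sq hk] at h
  linarith

end ClassCounts

/-! ## §3 Examples: `deg Z(16) = 1`, `deg Z(48) = 2/3`, `deg Z(2401) = 65`, `|L(49)/O₆^×| = 10` -/

section Examples

/-- **`deg Z(16)_ℚ = 1`** (`16 = 4²`, no prime factor `≥ 5`). [cite: KudlaRapoportYang2006, §3.4 (3.4.4)–(3.4.6) and (3.4.14)] -/
theorem degree_sixteen : 2 * ∑ᶠ q : (Quot (fun x y : {x : ℤ × ℤ × ℤ // x.1 ^ 2 - 3 * x.2.1 ^ 2 - 3 * x.2.2 ^ 2 = (16 : ℤ)} ↦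
      ∃ v : ℍ[ℚ,((-1 : ℤ) : ℚ),((3 : ℤ) : ℚ)], (v ∈ order (-1) 3 ∨ v - ⟨1/2, 1/2, 1/2, -1/2⟩ ∈ order (-1) 3) ∧
        ((v * star v).re = 1 ∨ (v * star v).re = -1) ∧
        v * ⟨0, x.1.1, x.1.2.1, x.1.2.2⟩ = ⟨0, y.1.1, y.1.2.1, y.1.2.2⟩ * v)),
        ((Nat.card
          {u : ℍ[ℚ,((-1 : ℤ) : ℚ),((3 : ℤ) : ℚ)] // (u ∈ order (-1) 3 ∨ u - ⟨1/2, 1/2, 1/2, -1/2⟩ ∈ order (-1) 3) ∧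
            ((u * star u).re = 1 ∨ (u * star u).re = -1) ∧
            u * ⟨0, q.out.1.1, q.out.1.2.1, q.out.1.2.2⟩ = ⟨0, q.out.1.1, q.out.1.2.1, q.out.1.2.2⟩ * u} : ℚ))⁻¹ = 1 := by
  have h := degree_sq_eq_one_of_primeFactors_subset (k := 4) (by norm_num)
    (by rw [show (4 : ℕ) = 2 ^ 2 from rfl, Nat.primeFactors_prime_pow two_ne_zero Nat.prime_two]; decide)
  have e : ((4 ^ 2 : ℕ) : ℤ) = 16 := by norm_num
  rwa [e] at h

/-- **`deg Z(48)_ℚ = 2/3`** (`48 = 3·4²`). [cite: KudlaRapoportYang2006, §3.4 (3.4.4)–(3.4.6) and (3.4.14)] -/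
theorem degree_fortyeight : 2 * ∑ᶠ q : (Quot (fun x y : {x : ℤ × ℤ × ℤ // x.1 ^ 2 - 3 * x.2.1 ^ 2 - 3 * x.2.2 ^ 2 = (48 : ℤ)} ↦
      ∃ v : ℍ[ℚ,((-1 : ℤ) : ℚ),((3 : ℤ) : ℚ)], (v ∈ order (-1) 3 ∨ v - ⟨1/2, 1/2, 1/2, -1/2⟩ ∈ order (-1) 3) ∧
        ((v * star v).re = 1 ∨ (v * star v).re = -1) ∧
        v * ⟨0, x.1.1, x.1.2.1, x.1.2.2⟩ = ⟨0, y.1.1, y.1.2.1, y.1.2.2⟩ * v)),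
        ((Nat.card
          {u : ℍ[ℚ,((-1 : ℤ) : ℚ),((3 : ℤ) : ℚ)] // (u ∈ order (-1) 3 ∨ u - ⟨1/2, 1/2, 1/2, -1/2⟩ ∈ order (-1) 3) ∧
            ((u * star u).re = 1 ∨ (u * star u).re = -1) ∧
            u * ⟨0, q.out.1.1, q.out.1.2.1, q.out.1.2.2⟩ = ⟨0, q.out.1.1, q.out.1.2.1, q.out.1.2.2⟩ * u} : ℚ))⁻¹ = 2 / 3 := by
  have h := degree_three_mul_sq_eq_of_primeFactors_subset (k := 4) (by norm_num)
    (by rw [show (4 : ℕ) = 2 ^ 2 from rfl, Nat.primeFactors_prime_pow two_ne_zero Nat.prime_two]; decide)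
  have e : ((3 * 4 ^ 2 : ℕ) : ℤ) = 48 := by norm_num
  rwa [e] at h

/-- **`deg Z(2401)_ℚ = 1 + (7 − χ₄(7))·(1 + 7) = 65`** (`2401 = 7⁴`; new value).
[cite: KudlaRapoportYang2006, §3.4 (3.4.4)–(3.4.6)] -/
theorem degree_twothousandfourhundredone : 2 * ∑ᶠ q : (Quot (fun x y : {x : ℤ × ℤ × ℤ // x.1 ^ 2 - 3 * x.2.1 ^ 2 - 3 * x.2.2 ^ 2 = (2401 : ℤ)} ↦
      ∃ v : ℍ[ℚ,((-1 : ℤ) : ℚ),((3 : ℤ) : ℚ)], (v ∈ order (-1) 3 ∨ v - ⟨1/2, 1/2, 1/2, -1/2⟩ ∈ order (-1) 3) ∧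
        ((v * star v).re = 1 ∨ (v * star v).re = -1) ∧
        v * ⟨0, x.1.1, x.1.2.1, x.1.2.2⟩ = ⟨0, y.1.1, y.1.2.1, y.1.2.2⟩ * v)),
        ((Nat.card
          {u : ℍ[ℚ,((-1 : ℤ) : ℚ),((3 : ℤ) : ℚ)] // (u ∈ order (-1) 3 ∨ u - ⟨1/2, 1/2, 1/2, -1/2⟩ ∈ order (-1) 3) ∧
            ((u * star u).re = 1 ∨ (u * star u).re = -1) ∧
            u * ⟨0, q.out.1.1, q.out.1.2.1, q.out.1.2.2⟩ = ⟨0, q.out.1.1, q.out.1.2.1, q.out.1.2.2⟩ * u} : ℚ))⁻¹ = 65 := by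
  have h := degree_prime_pow_sq (p := 7) (by norm_num) (by norm_num) (by norm_num) 2
  have hχ : ZMod.χ₄ ((7 : ℕ) : ZMod 4) = -1 := by decide
  have e : ((7 ^ (2 * 2) : ℕ) : ℤ) = 2401 := by norm_num
  rw [hχ, e, Finset.sum_range_succ, Finset.sum_range_one] at h
  rw [h]; norm_num

/-- **`|L(49)/O₆^×| = 1 + (1 + 7·(1 − χ₄(7)/7)) = 10`** (new value; `deg Z(49)_ℚ = 9`).
[cite: KudlaRapoportYang2006, §3.4 (3.4.4)–(3.4.6) and (3.4.14)] [cite: Eichler1955, Satz 5] -/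
theorem card_unit_classes_fortynine : (Nat.card (Quot (fun x y : {x : ℤ × ℤ × ℤ // x.1 ^ 2 - 3 * x.2.1 ^ 2 - 3 * x.2.2 ^ 2 = (49 : ℤ)} ↦
      ∃ v : ℍ[ℚ,((-1 : ℤ) : ℚ),((3 : ℤ) : ℚ)], (v ∈ order (-1) 3 ∨ v - ⟨1/2, 1/2, 1/2, -1/2⟩ ∈ order (-1) 3) ∧
        ((v * star v).re = 1 ∨ (v * star v).re = -1) ∧
        v * ⟨0, x.1.1, x.1.2.1, x.1.2.2⟩ = ⟨0, y.1.1, y.1.2.1, y.1.2.2⟩ * v)) : ℚ) = 10 := by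
  have h := card_unit_classes_sq (k := 7) (by norm_num)
  have e : ((7 ^ 2 : ℕ) : ℤ) = 49 := by norm_num
  rw [e, show ((7 : ℕ).divisors.filter fun c : ℕ => c.Coprime 6) = {1, 7} by decide, Finset.sum_pair (by norm_num),
    Nat.primeFactors_one, Nat.Prime.primeFactors (by norm_num : (7 : ℕ).Prime), Finset.prod_empty,
    Finset.prod_singleton] at h
  have hχ : ZMod.χ₄ ((7 : ℕ) : ZMod 4) = -1 := by decide
  rw [hχ] at h
  rw [h]; norm_num

end Examples

end Literature.Geometry.Kaehler.ComplexTorus.QuaternionType
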